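import Summits.HodgeConjecture.CorCM.CMWeilSplitArithmeticCore
import Literature.AlgebraicGeometry.VanGeemen1994.WeilDiscriminantClass
import HarnessLib

/-!
# The arithmetic core (★) read on the maximal real subfield of a CM field, in the vocabulary of
# `VanGeemen1994/WeilDiscriminantOfCMTypeRealisation` (sequel of `CorCM/CMWeilSplitArithmeticCore`)

Cell `pub-hodgecm2` (COR-CM), binder seat b25 (gen 52), count-neutral own lane CM-WEIL-SPLIT; KERNEL ONLY (theorems;
no definition, no named fact, no `sorry`; `HC_CM` does not occur).

`Literature/AlgebraicGeometry/VanGeemen1994/WeilDiscriminantOfCMTypeRealisation.lean` reads the van Geemen class of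
the Rosati polarization of a CM-type realisation `(A, ι)` of `(F, Φ)`, `[F : ℚ] = 4n`, relative to `w ∈ 𝓞_F`,
`w² = -D`, as `[N_{F⁺/ℚ}(c) · d_{F⁺}] ∈ weilNormResidueGroup D` for a real scalar `c ∈ F⁺ = maximalRealSubfield F`
(`exists_hasWeilDiscriminantNondeg_of_isCMTypeRealisation`), and its module docstring lists as NOT there «which
classes occur as `ξ` varies … the arithmetic core (★): existence of `f ∈ F⁺` with prescribed signs and
`N_{F⁺/ℚ}(f) · d_{F⁺} ≡ (-1)ⁿ` — class field theory for `F/F⁺`».  This file supplies exactly that input, in exactly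
that shape, from the ELEMENTARY core `CMWeilSplit.exists_neg_iff_mem_and_mk_norm_mul_discr_eq` (no class field
theory):

* **`exists_neg_iff_mem_and_mk_eq_neg_one_pow_maximalRealSubfield`** — for a CM field `F` with `[F : ℚ] = 4n`, every
  set `S` of `n` real embeddings of `F⁺` and every `D`, there is `c ∈ F⁺`, negative exactly at the embeddings in `S`,
  with `N_{F⁺/ℚ}(c) · d_{F⁺} ≠ 0` and `[N_{F⁺/ℚ}(c) · d_{F⁺}] = [(-1)ⁿ]` in `weilNormResidueGroup D`
  (`= splitDiscriminantClass n D` of the ring-2 ladder).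

What is NOT here (unchanged): the carrier geometry turning this `c` into the Deligne coefficient of an actual
polarization CLASS with the right positivity (residuals (a)/(b) of the seat note) — `hS` of
`CorCM/SimpleCMSixfoldHodgeOfSplitWeilSixfolds.lean` stays displayed; HC_CM is NOT proved.

## References
* [vanGeemen1994HodgeAV] B. van Geemen, LNM 1594 (1994), Lemma 5.2, 5.4 / (5.4.1).
* [Deligne1982HodgeCycles] P. Deligne, LNM 900 (1982), §5 Prop. 5.1, §5 (c).
-/

noncomputable section

open NumberField Module

namespace Summit.HodgeConjecture.CorCM.CMWeilSplit

open Literature.AlgebraicGeometry.VanGeemen1994 (weilField weilNormResidueGroup)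

/-- **(★) on `F⁺`, in the shape of `exists_hasWeilDiscriminantNondeg_of_isCMTypeRealisation`.**  Let `F` be a CM
field with `[F : ℚ] = 4n`, `S` a set of `n` real embeddings of `F⁺ = maximalRealSubfield F`, and `D : ℕ`.  Then there
is `c ∈ F⁺` with `σ c < 0 ⟺ σ ∈ S`, `N_{F⁺/ℚ}(c) · d_{F⁺} ≠ 0`, and
`[N_{F⁺/ℚ}(c) · d_{F⁺}] = [(-1)ⁿ]` in `weilNormResidueGroup D = ℚˣ ⧸ Nm(ℚ(√-D)ˣ)` — the SPLIT class, whatever `D`.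
Proof: `[F⁺ : ℚ] = 2n` (`F/F⁺` quadratic), `[weilField D : ℚ] = 2`, and the core
`exists_neg_iff_mem_and_mk_norm_mul_discr_eq`. [folklore] -/
theorem exists_neg_iff_mem_and_mk_eq_neg_one_pow_maximalRealSubfield (F : Type*) [Field F] [NumberField F]
    [IsCMField F] {n : ℕ} (hF : finrank ℚ F = 4 * n) (S : Finset (maximalRealSubfield F →+* ℝ)) (hS : S.card = n)
    (D : ℕ) :
    ∃ c : maximalRealSubfield F, (∀ σ : maximalRealSubfield F →+* ℝ, σ c < 0 ↔ σ ∈ S) ∧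
      ∃ hnd : Algebra.norm ℚ c * (NumberField.discr (maximalRealSubfield F) : ℚ) ≠ 0,
        (QuotientGroup.mk (Units.mk0 _ hnd) : weilNormResidueGroup D) = QuotientGroup.mk ((-1 : ℚˣ) ^ n) := by
  have hFp : finrank ℚ (maximalRealSubfield F) = 2 * n := by
    have h2 := Module.finrank_mul_finrank ℚ (maximalRealSubfield F) F
    rw [Algebra.IsQuadraticExtension.finrank_eq_two (maximalRealSubfield F) F, hF] at h2
    omega
  have hK2 : finrank ℚ (weilField D) = 2 := by
    rw [(AdjoinRoot.powerBasis' (Polynomial.monic_X_pow_add_C _ two_ne_zero)).finrank,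
      AdjoinRoot.powerBasis'_dim, Polynomial.natDegree_X_pow_add_C]
  obtain ⟨c, hc, hnd, hmk⟩ := exists_neg_iff_mem_and_mk_norm_mul_discr_eq (maximalRealSubfield F) S
    (by rw [hFp, hS]) (weilField D) hK2
  exact ⟨c, hc, hnd, by simpa only [hS] using hmk⟩

end Summit.HodgeConjecture.CorCM.CMWeilSplit

end
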